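import Literature.MathematicalPhysics.QuantumManyBody.GroundStateFeynmanKacProofs
import HarnessLib

/-!
# Route BECCutLineWeakDisorder — `WitnessTransfer`, II: two spectral bounds for `e^{-tH_N}`

Support file (does not close the item) for item stmt-AtomisticToContinuum-14978
(`Summit.AtomisticToContinuum.BoseEinsteinCondensation.Theses.BECCutLineWeakDisorder.WitnessTransfer`).
The transfer of the two-replica bound from the finite-`T` Feynman–Kac witnesses
`Ψ_T = e^{-TH_N}1/‖e^{-TH_N}1‖₂` to the ground state `Ψ₀` needs `Ψ_T → Ψ₀` with a bound on `Ψ_T`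
UNIFORM in `T ≥ 1`, i.e. an upper bound `(e^{-TH_N}1)(X) ≲ e^{-E₀T}` at the exact rate
`E₀ = groundStateEnergy v N L`. This file supplies the two spectral inputs, for a bounded measurable
pair potential `v` and a Feynman–Kac ground state `Ψ₀` (`IsGroundStateFK v L Ψ₀`, the structure
discharged by `GroundStateFeynmanKac_holds`):

* `norm_fkL2_one_le_exp_neg` — **`‖e^{-H_N}‖_{L²(Λ)→L²(Λ)} ≤ e^{-E₀}`**: the Perron–Frobenius
  eigenvector `e ≥ 0` of `T_1 = e^{-H_N}` (`fkL2_perronFrobenius`) has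
  `(T_{k+1} e)(X) = ‖T_1‖^k (T_1 e)(X)` at every point, while the ground-state projection limit of
  `IsGroundStateFK` says `e^{E₀(k+1)} (T_{k+1} e)(X)` converges to a finite limit; at a point with
  `(T_1 e)(X) > 0` this forces `e^{E₀}‖T_1‖ ≤ 1` (Chung–Zhao (1995) Thm 3.27: `‖T_t‖₂ = e^{λ₁t}`
  with `λ₁ = -E₀`).
* `lintegral_fkSemigroup_one_le` — **`∫_Λ (e^{-sH_N}1) ≤ ‖e^{-H_N}‖^s |Λ_L^N|`** (`s > 0`): the
  abstract Rayleigh bound `inner_semigroup_le_rpow_mul` for the constant function in `L²(Λ)`.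
* `lintegral_fkSemigroup_one_le_exp` — the two combined: `∫_Λ e^{-sH_N}1 ≤ e^{-E₀ s} |Λ_L^N|`,
  `s ≥ 0`.

## References

* K. L. Chung, Z. Zhao, *From Brownian Motion to Schrödinger's Equation* (1995), Thm 3.17,
  Thm 3.27. [ChungZhao1995]
-/

noncomputable section

open MeasureTheory Filter Set
open scoped ENNReal NNReal Topology InnerProductSpace

namespace Summit.AtomisticToContinuum.BoseEinsteinCondensation.Theorems.CutLineWitness

open Literature.MathematicalPhysics.QuantumManyBody.BoseGas

variable {N : ℕ}

/-- Cauchy–Schwarz: the overlap `⟨Ψ₀, g⟩ = ∫ Ψ₀ g` of a Feynman–Kac ground state with an `L²`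
observable `g ≥ 0` is finite. [folklore] -/
theorem lintegral_groundState_mul_ne_top {v : ℝ → ℝ≥0∞} {L : ℝ} {Ψ₀ : Config N → ℝ}
    (h : IsGroundStateFK v L Ψ₀) {g : Config N → ℝ≥0∞} (hg : Measurable g)
    (hg2 : ∫⁻ Y, g Y ^ 2 ≠ ⊤) : ∫⁻ Y, ENNReal.ofReal (Ψ₀ Y) * g Y ≠ ⊤ := by
  have hcs := ENNReal.lintegral_mul_le_Lp_mul_Lq volume Real.HolderConjugate.two_two
    h.measurable.ennreal_ofReal.aemeasurable hg.aemeasurable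
  refine ne_top_of_le_ne_top (ENNReal.mul_ne_top ?_ ?_) hcs
  · refine ENNReal.rpow_ne_top_of_nonneg (by norm_num) ?_
    have h1 : ∫⁻ Y, ENNReal.ofReal (Ψ₀ Y) ^ (2 : ℝ) = ∫⁻ Y, ENNReal.ofReal (Ψ₀ Y) ^ 2 :=
      lintegral_congr fun Y => ENNReal.rpow_two _
    rw [h1, h.norm_eq]; exact ENNReal.one_ne_top
  · refine ENNReal.rpow_ne_top_of_nonneg (by norm_num) ?_
    have h1 : ∫⁻ Y, g Y ^ (2 : ℝ) = ∫⁻ Y, g Y ^ 2 := lintegral_congr fun Y => ENNReal.rpow_two _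
    rwa [h1]

/-- **The Perron–Frobenius eigenfunction as a `[0, ∞]`-valued observable.** For a bounded
measurable pair potential and `L > 0` there is a measurable `g ≥ 0` with `∫ g² < ∞` (namely
`𝟙_Λ |e|` for the unit eigenvector `e ≥ 0` of `T_1 = e^{-H_N}`, `fkL2_perronFrobenius`) such that
`e^{-H_N} g = ‖T_1‖ g` Lebesgue-a.e., with a point `X` where this identity holds and
`0 < g(X)`. [cite: ReedSimonIV1978, Thm XIII.44] -/
theorem exists_fkSemigroup_eigen_ae {v : ℝ → ℝ≥0∞} (hv : Measurable v) {C : ℝ≥0}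
    (hC : ∀ r, v r ≤ C) {L : ℝ} (hL : 0 < L) :
    ∃ g : Config N → ℝ≥0∞, Measurable g ∧ ∫⁻ Y, g Y ^ 2 ≠ ⊤ ∧
      ((fun Y => fkSemigroup v L 1 g Y) =ᵐ[volume]
        fun Y => ENNReal.ofReal ‖fkL2 (N := N) v L 1‖ * g Y) ∧
      ∃ X, fkSemigroup v L 1 g X = ENNReal.ofReal ‖fkL2 (N := N) v L 1‖ * g X ∧ 0 < g X := by
  obtain ⟨hT0, e, -, he0, hSe, hepos, -⟩ := fkL2_perronFrobenius (N := N) hv hC hL one_pos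
  set μ₀ : ℝ := ‖fkL2 (N := N) v L 1‖ with hμ₀def
  have hμ₀ : 0 < μ₀ := norm_pos_iff.2 hT0
  -- the observable `g = 𝟙_Λ |e|`
  set er : Config N → ℝ := fun Y => |(e : Config N → ℝ) Y| with her
  have herm : Measurable er := (measurable_coeFn_Lp e).abs
  have her0 : ∀ Y, 0 ≤ er Y := fun Y => abs_nonneg _
  set g : Config N → ℝ≥0∞ := (boxN N L).indicator fun Y => ENNReal.ofReal (er Y) with hg
  have hgm : Measurable g := herm.ennreal_ofReal.indicator (measurableSet_boxN N L)
  have hg_eq : ∫⁻ Y, g Y ^ 2 = ∫⁻ Y in boxN N L, ‖(e : Config N → ℝ) Y‖ₑ ^ (2 : ℝ) := by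
    rw [← lintegral_indicator (measurableSet_boxN N L)]
    refine lintegral_congr fun Y => ?_
    by_cases hY : Y ∈ boxN N L
    · simp only [hg, Set.indicator_of_mem hY, ENNReal.rpow_two, her, Real.enorm_eq_ofReal_abs]
    · simp only [hg, Set.indicator_of_notMem hY, ne_eq, OfNat.ofNat_ne_zero, not_false_eq_true,
        zero_pow]
  have hg2 : ∫⁻ Y, g Y ^ 2 ≠ ⊤ := by rw [hg_eq]; exact setLIntegral_enorm_sq_ne_top e
  have hg2' : ∫⁻ Y, g Y ^ (2 : ℝ) ≠ ⊤ := by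
    have h1 : ∫⁻ Y, g Y ^ (2 : ℝ) = ∫⁻ Y, g Y ^ 2 := lintegral_congr fun Y => ENNReal.rpow_two _
    rwa [h1]
  -- the functional of `g` is that of `er`, and finite
  have hfin : ∀ X, fkSemigroup v L 1 g X < ⊤ := fun X => fkSemigroup_lt_top v L one_pos hgm hg2' X
  have hsg : ∀ X, fkSemigroup v L 1 g X = ENNReal.ofReal (fkReal v L 1 er X) := fun X => by
    rw [fkReal_eq_toReal_fkSemigroup hv L 1 herm her0 X]
    rw [show fkSemigroup v L 1 (fun Y => ENNReal.ofReal (er Y)) X = fkSemigroup v L 1 g X by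
      rw [hg, fkSemigroup_indicator v L zero_le_one], ENNReal.ofReal_toReal (hfin X).ne]
  -- the eigen-relation, a.e. on the box
  have hcoe : ((fkL2 v L 1 e : Lp ℝ 2 (volume.restrict (boxN N L))) : Config N → ℝ)
      =ᵐ[volume.restrict (boxN N L)] fun Y => μ₀ * (e : Config N → ℝ) Y := by
    rw [hSe]
    filter_upwards [Lp.coeFn_smul μ₀ e] with Y hY
    rw [hY, Pi.smul_apply, smul_eq_mul]
  have hreal : fkReal v L 1 (e : Config N → ℝ) =ᵐ[volume.restrict (boxN N L)]
      fun Y => μ₀ * (e : Config N → ℝ) Y :=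
    (fkL2_coeFn hv L one_pos e).symm.trans hcoe
  have he0' : ∀ᵐ Y ∂volume.restrict (boxN N L), 0 ≤ (e : Config N → ℝ) Y :=
    (Lp.coeFn_nonneg e).2 he0
  have habs : er =ᵐ[volume.restrict (boxN N L)] (e : Config N → ℝ) := by
    filter_upwards [he0'] with Y hY; exact abs_of_nonneg hY
  have her_e : ∀ X, fkReal v L 1 er X = fkReal v L 1 (e : Config N → ℝ) X :=
    fun X => fkReal_congr_ae_restrict v L one_pos habs X
  have hbox : ∀ᵐ Y ∂volume.restrict (boxN N L),
      fkSemigroup v L 1 g Y = ENNReal.ofReal μ₀ * g Y ∧ 0 < g Y := by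
    filter_upwards [hreal, hepos, ae_restrict_mem (measurableSet_boxN N L)] with Y h1 h2 h3
    have hgY : g Y = ENNReal.ofReal ((e : Config N → ℝ) Y) := by
      rw [hg, Set.indicator_of_mem h3]
      simp only [her, abs_of_pos h2]
    refine ⟨?_, ?_⟩
    · rw [hsg Y, her_e Y, h1, ENNReal.ofReal_mul hμ₀.le, hgY]
    · rw [hgY]; exact ENNReal.ofReal_pos.2 h2
  have hae : (fun Y => fkSemigroup v L 1 g Y) =ᵐ[volume] fun Y => ENNReal.ofReal μ₀ * g Y := by
    refine ae_of_ae_restrict_of_ae_restrict_compl (boxN N L) ?_ ?_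
    · filter_upwards [hbox] with Y hY; exact hY.1
    · filter_upwards [ae_restrict_mem (measurableSet_boxN N L).compl] with Y hY
      have hY' : Y ∉ boxN N L := hY
      simp only [hg, Set.indicator_of_notMem hY', mul_zero]
      exact fkSemigroup_of_notMem v zero_le_one _ hY'
  haveI : (ae (volume.restrict (boxN N L) : Measure (Config N))).NeBot :=
    ae_neBot.2 (restrict_boxN_ne_zero N hL)
  obtain ⟨X, hX1, hX2⟩ := hbox.exists
  exact ⟨g, hgm, hg2, hae, X, hX1, hX2⟩

/-- **Iterating an a.e. eigen-relation of the Feynman–Kac functional**: if `e^{-H_N}g = μ g`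
a.e. for a measurable `g ≥ 0`, then `(e^{-(k+1)H_N} g)(X) = μ^k (e^{-H_N} g)(X)` at EVERY point
(semigroup law, and the functional at positive time does not see null sets). [folklore] -/
theorem fkSemigroup_nat_succ_of_eigen_ae {v : ℝ → ℝ≥0∞} (hv : Measurable v) (L : ℝ)
    {g : Config N → ℝ≥0∞} (hgm : Measurable g) {μ : ℝ≥0}
    (hae : (fun Y => fkSemigroup v L 1 g Y) =ᵐ[volume] fun Y => (μ : ℝ≥0∞) * g Y)
    (k : ℕ) (X : Config N) :
    fkSemigroup v L ((k : ℝ) + 1) g X = (μ : ℝ≥0∞) ^ k * fkSemigroup v L 1 g X := by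
  have hstep : ∀ t : ℝ, 0 < t → ∀ X, fkSemigroup v L (t + 1) g X =
      (μ : ℝ≥0∞) * fkSemigroup v L t g X := fun t ht X => by
    rw [fkSemigroup_add hv L ht.le zero_le_one hgm X, fkSemigroup_congr_ae v L ht hae X]
    exact fkSemigroup_const_mul v L t μ g X
  induction k with
  | zero => rw [Nat.cast_zero, zero_add, pow_zero, one_mul]
  | succ k ih =>
    have hk : (0 : ℝ) < (k : ℝ) + 1 := by positivity
    rw [Nat.cast_succ, hstep _ hk X, ih, ← mul_assoc, pow_succ, mul_comm ((μ : ℝ≥0∞) ^ k)]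

/-- **`‖e^{-H_N}‖ ≤ e^{-E₀}` on `L²(Λ_L^N)`** for a bounded measurable pair potential, `L > 0`,
and a Feynman–Kac ground state `Ψ₀` with `E₀ = groundStateEnergy v N L`: the Perron–Frobenius
eigenvalue `‖T_1‖` of `T_1 = e^{-H_N}` cannot exceed `e^{-E₀}`, since along `T = k + 1` the
renormalised functional `e^{E₀T}(T_T g)(X) = e^{E₀} (e^{E₀}‖T_1‖)^k (T_1 g)(X)` of the nonnegative
eigenfunction `g` converges (ground-state projection of `IsGroundStateFK`) to a finite limit.
Chung–Zhao (1995), Thm 3.27 (`‖T_t‖₂ = e^{λ₁ t}`). [cite: ChungZhao1995, Thm 3.27] -/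
theorem norm_fkL2_one_le_exp_neg {v : ℝ → ℝ≥0∞} (hv : Measurable v) {C : ℝ≥0}
    (hC : ∀ r, v r ≤ C) {L : ℝ} (hL : 0 < L) {Ψ₀ : Config N → ℝ} (h : IsGroundStateFK v L Ψ₀) :
    ‖fkL2 (N := N) v L 1‖ ≤ Real.exp (-(groundStateEnergy v N L).toReal) := by
  obtain ⟨g, hgm, hg2, hae, X, hX1, hX2⟩ := exists_fkSemigroup_eigen_ae (N := N) hv hC hL
  set μ₀ : ℝ := ‖fkL2 (N := N) v L 1‖ with hμ₀def
  have hμ₀0 : 0 ≤ μ₀ := norm_nonneg _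
  set m0 : ℝ≥0 := ⟨μ₀, hμ₀0⟩ with hm0
  have hm0c : ENNReal.ofReal μ₀ = (m0 : ℝ≥0∞) := ENNReal.ofReal_eq_coe_nnreal hμ₀0
  set E : ℝ := (groundStateEnergy v N L).toReal with hE
  rw [hm0c] at hae hX1
  have hiter := fkSemigroup_nat_succ_of_eigen_ae hv L hgm hae
  -- `F = (T_1 g)(X) < ∞`
  have hFt : fkSemigroup v L 1 g X ≠ ⊤ := by
    refine (fkSemigroup_lt_top v L one_pos hgm ?_ X).ne
    have h1 : ∫⁻ Y, g Y ^ (2 : ℝ) = ∫⁻ Y, g Y ^ 2 := lintegral_congr fun Y => ENNReal.rpow_two _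
    rwa [h1]
  -- the ground-state projection limit along `T = k + 1`
  have hlim := (h.tendsto g hgm hg2 X).comp
    (tendsto_atTop_add_const_right atTop (1 : ℝ) tendsto_natCast_atTop_atTop)
  have hLimt : (∫⁻ Y, ENNReal.ofReal (Ψ₀ Y) * g Y) * ENNReal.ofReal (Ψ₀ X) ≠ ⊤ :=
    ENNReal.mul_ne_top (lintegral_groundState_mul_ne_top h hgm hg2) ENNReal.ofReal_ne_top
  set q : ℝ≥0∞ := ENNReal.ofReal (Real.exp E) * (m0 : ℝ≥0∞) with hq
  have hform : (fun T : ℝ => ENNReal.ofReal (Real.exp ((groundStateEnergy v N L).toReal * T)) *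
      fkSemigroup v L T g X) ∘ (fun k : ℕ => (k : ℝ) + 1) =
      fun k : ℕ => ENNReal.ofReal (Real.exp E) * fkSemigroup v L 1 g X * q ^ k := by
    funext k
    simp only [Function.comp_apply]
    rw [hiter k X, ← hE, show E * ((k : ℝ) + 1) = (k : ℕ) * E + E by ring, Real.exp_add,
      Real.exp_nat_mul, ENNReal.ofReal_mul (by positivity), ENNReal.ofReal_pow (Real.exp_pos E).le,
      hq, mul_pow]
    ring
  rw [hform] at hlim
  -- if `e^{E₀} ‖T_1‖ > 1` the sequence diverges
  by_contra hcon
  rw [not_le] at hcon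
  have hμ₀ : 0 < μ₀ := (Real.exp_pos _).trans hcon
  have hF0 : fkSemigroup v L 1 g X ≠ 0 := by
    have hm00 : (m0 : ℝ≥0∞) ≠ 0 := by rw [← hm0c]; exact (ENNReal.ofReal_pos.2 hμ₀).ne'
    rw [hX1]; exact mul_ne_zero hm00 hX2.ne'
  have hq1 : 1 < q := by
    rw [hq, ← hm0c, ← ENNReal.ofReal_mul (Real.exp_pos E).le, ENNReal.one_lt_ofReal]
    calc (1 : ℝ) = Real.exp E * Real.exp (-E) := by
          rw [← Real.exp_add, add_neg_cancel, Real.exp_zero]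
      _ < Real.exp E * μ₀ := mul_lt_mul_of_pos_left hcon (Real.exp_pos E)
  have htop : Tendsto (fun k : ℕ => ENNReal.ofReal (Real.exp E) * fkSemigroup v L 1 g X * q ^ k)
      atTop (𝓝 ⊤) := by
    have h1 : Tendsto (fun k : ℕ => q ^ k) atTop (𝓝 ⊤) :=
      ENNReal.tendsto_pow_atTop_nhds_top_iff.2 hq1
    have hc0 : ENNReal.ofReal (Real.exp E) * fkSemigroup v L 1 g X ≠ 0 :=
      mul_ne_zero (ENNReal.ofReal_pos.2 (Real.exp_pos E)).ne' hF0
    have h2 := ENNReal.Tendsto.const_mul h1 (Or.inl ENNReal.top_ne_zero)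
      (a := ENNReal.ofReal (Real.exp E) * fkSemigroup v L 1 g X)
    rwa [ENNReal.mul_top hc0] at h2
  exact hLimt (tendsto_nhds_unique hlim htop)

/-- **Rayleigh bound for the constant function**: for `s > 0`,
`∫_Λ (e^{-sH_N} 1)(X) dX = ⟪𝟙, e^{-sH_N} 𝟙⟫_{L²(Λ)} ≤ ‖e^{-H_N}‖^s |Λ_L^N|` (the abstract bound
`inner_semigroup_le_rpow_mul` for the self-adjoint contraction semigroup `fkL2`, read back as a
Lebesgue integral of the `[0, ∞]`-valued functional). Chung–Zhao (1995), Thm 3.27.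
[cite: ChungZhao1995, Thm 3.27] -/
theorem lintegral_fkSemigroup_one_le {v : ℝ → ℝ≥0∞} (hv : Measurable v) {C : ℝ≥0}
    (hC : ∀ r, v r ≤ C) {L : ℝ} (hL : 0 < L) {s : ℝ} (hs : 0 < s) :
    ∫⁻ X : Config N, fkSemigroup v L s (fun _ => (1 : ℝ≥0∞)) X ≤
      ENNReal.ofReal (‖fkL2 (N := N) v L 1‖ ^ s) * volume (boxN N L) := by
  set μ : Measure (Config N) := volume.restrict (boxN N L) with hμ
  haveI : IsFiniteMeasure μ := ⟨by rw [hμ, Measure.restrict_apply_univ]; exact volume_boxN_lt_top N L⟩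
  set F : Lp ℝ 2 μ := indicatorConstLp 2 MeasurableSet.univ (measure_ne_top μ _) (1 : ℝ) with hFdef
  have hF : (F : Config N → ℝ) =ᵐ[μ] fun _ => 1 := by
    filter_upwards [indicatorConstLp_coeFn (p := 2) (μ := μ) (s := Set.univ)
      (hs := MeasurableSet.univ) (hμs := measure_ne_top μ _) (c := (1 : ℝ))] with X hX
    rw [hX]; simp
  -- the abstract Rayleigh bound
  have hadd : ∀ s t : ℝ, 0 < s → 0 < t →
      fkL2 (N := N) v L (s + t) = (fkL2 v L s).comp (fkL2 v L t) :=
    fun s t hs ht => fkL2_add_time hv L hs ht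
  have hcontr : ∀ t : ℝ, 0 < t → ‖fkL2 (N := N) v L t‖ ≤ 1 := fun t _ => norm_fkL2_le_one v L t
  have hsym : ∀ t : ℝ, 0 < t → ∀ x y : Lp ℝ 2 μ,
      ⟪fkL2 v L t x, y⟫_ℝ = ⟪x, fkL2 v L t y⟫_ℝ := fun t ht x y => inner_fkL2_comm hv L ht x y
  have hμ₀ : 0 < ‖fkL2 (N := N) v L 1‖ :=
    norm_pos_iff.2 (fkL2_perronFrobenius (N := N) hv hC hL one_pos).1
  have h1 := inner_semigroup_le_rpow_mul (S := fun t => fkL2 (N := N) v L t) hadd hcontr hsym hμ₀ F hs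
  -- `‖F‖² = |Λ|`
  have hnorm : ‖F‖ ^ 2 = (volume (boxN N L)).toReal := by
    rw [hFdef, norm_indicatorConstLp two_ne_zero ENNReal.ofNat_ne_top, norm_one, one_mul,
      ENNReal.toReal_ofNat, show (1 : ℝ) / 2 = ((2 : ℕ) : ℝ)⁻¹ by norm_num,
      Real.rpow_inv_natCast_pow measureReal_nonneg two_ne_zero, measureReal_def, hμ,
      Measure.restrict_apply_univ]
  -- `⟪F, T_s F⟫ = ∫_Λ (T_s 1).toReal`
  have hone : ∀ X : Config N, fkReal v L s (fun _ => (1 : ℝ)) X =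
      (fkSemigroup v L s (fun _ => (1 : ℝ≥0∞)) X).toReal := fun X => by
    rw [fkReal_eq_toReal_fkSemigroup hv L s measurable_const (fun _ => zero_le_one) X]
    simp
  have hinner : ⟪F, fkL2 v L s F⟫_ℝ = ∫ X in boxN N L, (fkSemigroup v L s (fun _ => (1 : ℝ≥0∞)) X).toReal := by
    rw [inner_Lp_eq_integral]
    refine integral_congr_ae ?_
    filter_upwards [hF, fkL2_coeFn hv L hs F] with X hX hTX
    rw [hX, hTX, one_mul, fkReal_congr_ae_restrict v L hs hF X, hone X]
  -- the left-hand side as a Bochner integral over the box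
  have hle1 : ∀ X : Config N, fkSemigroup v L s (fun _ => (1 : ℝ≥0∞)) X ≤ 1 :=
    fun X => fkPartition_le_one v L s X
  have hmeas : Measurable fun X : Config N => fkSemigroup v L s (fun _ => (1 : ℝ≥0∞)) X :=
    measurable_fkSemigroup hv L s measurable_const
  have hint : Integrable (fun X : Config N => (fkSemigroup v L s (fun _ => (1 : ℝ≥0∞)) X).toReal) μ := by
    refine (integrable_const (1 : ℝ)).mono' hmeas.ennreal_toReal.aestronglyMeasurable
      (Eventually.of_forall fun X => ?_)
    rw [Real.norm_eq_abs, abs_of_nonneg ENNReal.toReal_nonneg]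
    exact ENNReal.toReal_le_of_le_ofReal zero_le_one (by simpa using hle1 X)
  have hlhs : ∫⁻ X : Config N, fkSemigroup v L s (fun _ => (1 : ℝ≥0∞)) X =
      ENNReal.ofReal (∫ X in boxN N L, (fkSemigroup v L s (fun _ => (1 : ℝ≥0∞)) X).toReal) := by
    have h0 : ∫⁻ X : Config N, fkSemigroup v L s (fun _ => (1 : ℝ≥0∞)) X =
        ∫⁻ X in boxN N L, fkSemigroup v L s (fun _ => (1 : ℝ≥0∞)) X := by
      rw [← lintegral_indicator (measurableSet_boxN N L)]
      refine lintegral_congr fun X => ?_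
      by_cases hX : X ∈ boxN N L
      · rw [Set.indicator_of_mem hX]
      · rw [Set.indicator_of_notMem hX, fkSemigroup_of_notMem v hs.le _ hX]
    rw [h0, ofReal_integral_eq_lintegral_ofReal hint (Eventually.of_forall fun X => ENNReal.toReal_nonneg)]
    refine lintegral_congr fun X => ?_
    rw [ENNReal.ofReal_toReal (ne_top_of_le_ne_top ENNReal.one_ne_top (hle1 X))]
  rw [hlhs, ← hinner, ← ENNReal.ofReal_toReal (volume_boxN_lt_top N L).ne, ← ENNReal.ofReal_mul
    (Real.rpow_nonneg (norm_nonneg _) _), ← hnorm]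
  exact ENNReal.ofReal_le_ofReal h1

/-- **`∫_Λ e^{-sH_N} 1 ≤ e^{-E₀ s} |Λ_L^N|` for all `s ≥ 0`**, `E₀ = groundStateEnergy v N L`, for a
bounded measurable pair potential with a Feynman–Kac ground state (`norm_fkL2_one_le_exp_neg` in
`lintegral_fkSemigroup_one_le`; equality of boxes at `s = 0`). [cite: ChungZhao1995, Thm 3.27] -/
theorem lintegral_fkSemigroup_one_le_exp {v : ℝ → ℝ≥0∞} (hv : Measurable v) {C : ℝ≥0}
    (hC : ∀ r, v r ≤ C) {L : ℝ} (hL : 0 < L) {Ψ₀ : Config N → ℝ} (h : IsGroundStateFK v L Ψ₀)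
    {s : ℝ} (hs : 0 ≤ s) :
    ∫⁻ X : Config N, fkSemigroup v L s (fun _ => (1 : ℝ≥0∞)) X ≤
      ENNReal.ofReal (Real.exp (-((groundStateEnergy v N L).toReal * s))) * volume (boxN N L) := by
  rcases hs.eq_or_lt with rfl | hs'
  · rw [mul_zero, neg_zero, Real.exp_zero, ENNReal.ofReal_one, one_mul,
      ← setLIntegral_one, ← lintegral_indicator (measurableSet_boxN N L)]
    refine le_of_eq (lintegral_congr fun X => ?_)
    rw [fkSemigroup_zero]
  refine (lintegral_fkSemigroup_one_le hv hC hL hs').trans (mul_le_mul' (ENNReal.ofReal_le_ofReal ?_) le_rfl)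
  have hμ₀ : 0 < ‖fkL2 (N := N) v L 1‖ :=
    norm_pos_iff.2 (fkL2_perronFrobenius (N := N) hv hC hL one_pos).1
  calc ‖fkL2 (N := N) v L 1‖ ^ s ≤ Real.exp (-(groundStateEnergy v N L).toReal) ^ s :=
        Real.rpow_le_rpow hμ₀.le (norm_fkL2_one_le_exp_neg hv hC hL h) hs
    _ = Real.exp (-((groundStateEnergy v N L).toReal * s)) := by
        rw [← Real.exp_mul]; ring_nf

end Summit.AtomisticToContinuum.BoseEinsteinCondensation.Theorems.CutLineWitness

end
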